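import Summits.RiemannHypothesis.RiemannHypothesis.Theses.SignCone
import Summits.RiemannHypothesis.RiemannHypothesis.Theorems.SignConeSignConeOscillatoryTwoBump
import Literature.NumberTheory.LFunctions.WeilArchimedeanPositivityProofs
import Literature.NumberTheory.LFunctions.WeilArchimedeanMoments

/-!
# `SignConeOscillatory` (crux stmt-RiemannHypothesis-16302) — negative lemma: node non-negativity is load-bearing

Crux-disprover record (seat `refuter-cdisprove-stmt-RiemannHypothesis-16302-0`), companion of the crux workfile
`Cruxes/SignConeOscillatory/Disproof.lean`. No definitions: the mutated statement is the item text with ONE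
hypothesis deleted, spelled out inline.

The crux `Summit.RiemannHypothesis.RiemannHypothesis.Theses.SignCone.SignConeOscillatory` asserts
`-Re F(0) ≤ Re W_ar(F)` (`W_ar = weilPolarTerm + weilArchTerm`) for every autocorrelation sum `F = Σᵢ gᵢ ⋆ g̃ᵢ` of
Weil tests supported in `[-a, a]` that is NON-NEGATIVE AT THE NODES (`Re F(log n) ≥ 0`, `n ≥ 2`) and negative
somewhere on `|t| ≥ log 2`. The item record carries numerical evidence that the node hypothesis is load-bearing
(rattack j020164: `W_ar/F(0) = -1.32` at `a = 2` for a node-negative test; ideator LP j020376: hn-free minima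
`-0.58 … -8.71`). This file makes it a theorem:

* `signConeOscillatory_false_without_nodeNonneg` — delete the node hypothesis (everything else verbatim): FALSE.
  Witness: `k = 1`, `g = w_c = φ(· + c/2) - φ(· - c/2)` (`φ = WeilContinuous.moll 0`, radius `1`), cutoff
  `a = c/2 + 1`, `c = 4(1 + K)` large. With `G = w_c ⋆ w̃_c`: `Re G(c) < 0` (oscillatory, `c ≥ log 2`);
  `Re weilPolarTerm G = 2 Re(ŵ(0) conj ŵ(1)) = -8 sinh²(c/4) φ̂(0) φ̂(1)` with `φ̂(0), φ̂(1) > 0`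
  (`re_weilPolarTerm_twoBump`) — the polar term of an ANTISYMMETRIC pair of far bumps is negative and grows like
  `-2 e^{c/2}`; the archimedean integral `∫ |ŵ(½+it)|² Re ψ(¼+it/2) dt` is bounded INDEPENDENTLY of `c`
  (`|ŵ|² = 4 sin²(tc/2)|φ̂|² ≤ 4|φ̂|²`, `Re ψ(¼+it/2) ≥ Re ψ(¼)`; `weilArchIntegral_twoBump_le`); and
  `Re G(0) = ‖w‖₂² ≥ 0` enters with the coefficient `1 - log π < 0`. Hence `Re W_ar(G) + Re G(0) → -∞`.

Reading for provers: the node signs are where ALL the arithmetic sits — without them the polar term alone sinks the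
inequality (no primes, no zeros involved); with them, `P_Λ(F) ≥ 0` and the statement is `RH`-implied
(`SignCone.signConeOscillatory_of_riemannHypothesis`). The witness is node-NEGATIVE exactly at the prime powers
near `e^{c}` that the polar term "sees" through the explicit formula.
-/

noncomputable section

-- `Summit.RiemannHypothesis.RiemannHypothesis.…` repeats a namespace component by design (D-0017 layout).
set_option linter.dupNamespace false

open scoped BigOperators ComplexConjugate Topology
open Complex MeasureTheory Set Filter

namespace Summit.RiemannHypothesis.RiemannHypothesis.Theorems.SignConeOscillatory.Negative

open Literature.NumberTheory.LFunctions
open Literature.Analysis.SpecialFunctions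
open Summit.RiemannHypothesis.RiemannHypothesis.Theorems.SignCone

/-! ## The Mellin transform of the two-bump test `w = φ(· + c/2) - φ(· - c/2)` -/

/-- `ŵ(s) = (e^{-(s-½)c/2} - e^{(s-½)c/2}) φ̂(s)`. [folklore] -/
theorem weilMellin_twoBump (N : ℕ) (c : ℝ) (s : ℂ) :
    weilMellin (fun u => WeilContinuous.moll N (u + c / 2) - WeilContinuous.moll N (u - c / 2)) s =
      (cexp ((s - 1 / 2) * ((-(c / 2) : ℝ) : ℂ)) - cexp ((s - 1 / 2) * ((c / 2 : ℝ) : ℂ))) *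
        weilMellin (WeilContinuous.moll N) s := by
  have hφ := WeilContinuous.isWeilTest_moll N
  have h1 : IsWeilTest (weilTranslate (WeilContinuous.moll N) (-(c / 2))) := hφ.weilTranslate _
  have h2 : IsWeilTest (fun t => (-1 : ℂ) * weilTranslate (WeilContinuous.moll N) (c / 2) t) :=
    (hφ.weilTranslate _).const_mul (-1)
  have e : (fun u => WeilContinuous.moll N (u + c / 2) - WeilContinuous.moll N (u - c / 2)) =
      weilTranslate (WeilContinuous.moll N) (-(c / 2)) +
        fun t => (-1 : ℂ) * weilTranslate (WeilContinuous.moll N) (c / 2) t := by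
    funext u
    simp only [Pi.add_apply, weilTranslate, sub_neg_eq_add]
    ring
  rw [e, weilMellin_add h1.1.continuous h1.2 h2.1.continuous h2.2, weilMellin_const_mul,
    weilMellin_weilTranslate, weilMellin_weilTranslate]
  ring

/-- On the critical line `|ŵ(½ + it)|² ≤ 4 |φ̂(½ + it)|²`. [folklore] -/
theorem norm_sq_weilMellin_twoBump_half_le (N : ℕ) (c t : ℝ) :
    ‖weilMellin (fun u => WeilContinuous.moll N (u + c / 2) - WeilContinuous.moll N (u - c / 2)) (1 / 2 + t * I)‖ ^ 2
      ≤ 4 * ‖weilMellin (WeilContinuous.moll N) (1 / 2 + t * I)‖ ^ 2 := by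
  rw [weilMellin_twoBump, norm_mul, mul_pow]
  have hx : ∀ x : ℝ, ‖cexp ((1 / 2 + (t : ℂ) * I - 1 / 2) * (x : ℂ))‖ = 1 := by
    intro x
    rw [show (1 / 2 + (t : ℂ) * I - 1 / 2) * (x : ℂ) = ((t * x : ℝ) : ℂ) * I by push_cast; ring]
    exact Complex.norm_exp_ofReal_mul_I _
  have hle : ‖cexp ((1 / 2 + (t : ℂ) * I - 1 / 2) * ((-(c / 2) : ℝ) : ℂ)) -
      cexp ((1 / 2 + (t : ℂ) * I - 1 / 2) * ((c / 2 : ℝ) : ℂ))‖ ≤ 2 := by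
    refine (norm_sub_le _ _).trans ?_
    rw [hx, hx]; norm_num
  have h4 : ‖cexp ((1 / 2 + (t : ℂ) * I - 1 / 2) * ((-(c / 2) : ℝ) : ℂ)) -
      cexp ((1 / 2 + (t : ℂ) * I - 1 / 2) * ((c / 2 : ℝ) : ℂ))‖ ^ 2 ≤ 4 := by
    nlinarith [norm_nonneg (cexp ((1 / 2 + (t : ℂ) * I - 1 / 2) * ((-(c / 2) : ℝ) : ℂ)) -
      cexp ((1 / 2 + (t : ℂ) * I - 1 / 2) * ((c / 2 : ℝ) : ℂ)))]
  exact mul_le_mul_of_nonneg_right h4 (sq_nonneg _)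

/-! ## The real numbers `φ̂(0) = ∫ φ e^{-t/2}`, `φ̂(1) = ∫ φ e^{t/2}` are positive -/

/-- `φ̂(0)` and `φ̂(1)` as real integrals. [folklore] -/
theorem weilMellin_moll_zero_one (N : ℕ) :
    weilMellin (WeilContinuous.moll N) 0 =
        ((∫ t : ℝ, (WeilContinuous.bump N).normed volume t * Real.exp (-(t / 2)) : ℝ) : ℂ) ∧
      weilMellin (WeilContinuous.moll N) 1 =
        ((∫ t : ℝ, (WeilContinuous.bump N).normed volume t * Real.exp (t / 2) : ℝ) : ℂ) := by
  unfold weilMellin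
  constructor
  · rw [← integral_complex_ofReal]
    congr 1 with t
    rw [show (0 - 1 / 2 : ℂ) * (t : ℂ) = ((-(t / 2) : ℝ) : ℂ) by push_cast; ring, ← Complex.ofReal_exp]
    simp only [WeilContinuous.moll]
    push_cast
    ring
  · rw [← integral_complex_ofReal]
    congr 1 with t
    rw [show (1 - 1 / 2 : ℂ) * (t : ℂ) = ((t / 2 : ℝ) : ℂ) by push_cast; ring, ← Complex.ofReal_exp]
    simp only [WeilContinuous.moll]
    push_cast
    ring

/-- `∫ φ(t) e^{λ t} dt > 0` (continuous non-negative integrand, positive at `0`). [folklore] -/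
theorem integral_bump_normed_mul_exp_pos (N : ℕ) (l : ℝ) :
    0 < ∫ t : ℝ, (WeilContinuous.bump N).normed volume t * Real.exp (l * t) := by
  set b := WeilContinuous.bump N
  have hcont : Continuous fun t : ℝ => b.normed volume t * Real.exp (l * t) :=
    b.continuous_normed.mul (by fun_prop)
  refine integral_pos_of_integrable_nonneg_nonzero (x := 0) hcont
    (hcont.integrable_of_hasCompactSupport b.hasCompactSupport_normed.mul_right)
    (fun t => mul_nonneg (b.nonneg_normed t) (Real.exp_pos _).le) ?_
  have h0 : b.normed volume 0 ≠ 0 := by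
    have : (0 : ℝ) ∈ Function.support (b.normed volume) := by
      rw [b.support_normed_eq]
      exact Metric.mem_ball_self b.rOut_pos
    exact this
  exact mul_ne_zero h0 (Real.exp_pos _).ne'

/-! ## The polar term of `w ⋆ w̃` -/

/-- **The polar term of the two-bump autocorrelation**:
`Re weilPolarTerm (w ⋆ w̃) = -8 sinh²(c/4) φ̂(0) φ̂(1)`. [folklore] -/
theorem re_weilPolarTerm_twoBump (N : ℕ) (c : ℝ) :
    (weilPolarTerm (weilConv (fun u => WeilContinuous.moll N (u + c / 2) - WeilContinuous.moll N (u - c / 2))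
      (weilReflect (fun u => WeilContinuous.moll N (u + c / 2) - WeilContinuous.moll N (u - c / 2))))).re =
      -8 * Real.sinh (c / 4) ^ 2 *
        (∫ t : ℝ, (WeilContinuous.bump N).normed volume t * Real.exp (-(t / 2))) *
        (∫ t : ℝ, (WeilContinuous.bump N).normed volume t * Real.exp (t / 2)) := by
  rw [weilPolarTerm_weilConv_weilReflect (isWeilTest_twoBump N c), Complex.ofReal_re, weilMellin_twoBump,
    weilMellin_twoBump, (weilMellin_moll_zero_one N).1, (weilMellin_moll_zero_one N).2]
  set I0 : ℝ := ∫ t : ℝ, (WeilContinuous.bump N).normed volume t * Real.exp (-(t / 2))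
  set I1 : ℝ := ∫ t : ℝ, (WeilContinuous.bump N).normed volume t * Real.exp (t / 2)
  have e0 : cexp ((0 - 1 / 2 : ℂ) * ((-(c / 2) : ℝ) : ℂ)) - cexp ((0 - 1 / 2 : ℂ) * ((c / 2 : ℝ) : ℂ)) =
      ((2 * Real.sinh (c / 4) : ℝ) : ℂ) := by
    rw [Real.sinh_eq]
    rw [show (0 - 1 / 2 : ℂ) * ((-(c / 2) : ℝ) : ℂ) = ((c / 4 : ℝ) : ℂ) by push_cast; ring,
      show (0 - 1 / 2 : ℂ) * ((c / 2 : ℝ) : ℂ) = ((-(c / 4) : ℝ) : ℂ) by push_cast; ring,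
      ← Complex.ofReal_exp, ← Complex.ofReal_exp]
    push_cast
    ring
  have e1 : cexp ((1 - 1 / 2 : ℂ) * ((-(c / 2) : ℝ) : ℂ)) - cexp ((1 - 1 / 2 : ℂ) * ((c / 2 : ℝ) : ℂ)) =
      ((-(2 * Real.sinh (c / 4)) : ℝ) : ℂ) := by
    rw [Real.sinh_eq]
    rw [show (1 - 1 / 2 : ℂ) * ((-(c / 2) : ℝ) : ℂ) = ((-(c / 4) : ℝ) : ℂ) by push_cast; ring,
      show (1 - 1 / 2 : ℂ) * ((c / 2 : ℝ) : ℂ) = ((c / 4 : ℝ) : ℂ) by push_cast; ring,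
      ← Complex.ofReal_exp, ← Complex.ofReal_exp]
    push_cast
    ring
  rw [e0, e1]
  rw [← Complex.ofReal_mul, ← Complex.ofReal_mul, Complex.conj_ofReal, ← Complex.ofReal_mul, Complex.ofReal_re]
  ring

/-! ## The archimedean integral of `w ⋆ w̃` is bounded independently of `c` -/

/-- **The archimedean integral of the two-bump autocorrelation is bounded independently of `c`**:
with `m = Re ψ(1/4)` (the minimum of `Re ψ(1/4 + it/2)`),
`∫ |ŵ(½+it)|² Re ψ(¼+it/2) dt ≤ 4 ∫ |φ̂(½+it)|² (Re ψ(¼+it/2) - m) dt + 4|m| ∫ |φ̂(½+it)|² dt`. [folklore] -/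
theorem weilArchIntegral_twoBump_le (N : ℕ) (c : ℝ) :
    (∫ t : ℝ, ‖weilMellin (fun u => WeilContinuous.moll N (u + c / 2) - WeilContinuous.moll N (u - c / 2))
        (1 / 2 + t * I)‖ ^ 2 * reDigammaQuarter t) ≤
      4 * (∫ t : ℝ, ‖weilMellin (WeilContinuous.moll N) (1 / 2 + t * I)‖ ^ 2 *
          (reDigammaQuarter t - reDigammaQuarter 0)) +
        4 * |reDigammaQuarter 0| * ∫ t : ℝ, ‖weilMellin (WeilContinuous.moll N) (1 / 2 + t * I)‖ ^ 2 := by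
  set w : ℝ → ℂ := fun u => WeilContinuous.moll N (u + c / 2) - WeilContinuous.moll N (u - c / 2) with hw_def
  have hw : IsWeilTest w := isWeilTest_twoBump N c
  have hφ : IsWeilTest (WeilContinuous.moll N) := WeilContinuous.isWeilTest_moll N
  set m : ℝ := reDigammaQuarter 0 with hm
  set W2 : ℝ → ℝ := fun t => ‖weilMellin w (1 / 2 + t * I)‖ ^ 2 with hW2
  set P2 : ℝ → ℝ := fun t => ‖weilMellin (WeilContinuous.moll N) (1 / 2 + t * I)‖ ^ 2 with hP2
  have hIw : Integrable fun t => W2 t * reDigammaQuarter t := integrable_norm_sq_weilMellin_mul_reDigammaQuarter hw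
  have hIw0 : Integrable W2 := integrable_norm_sq_weilMellin_half_line hw
  have hIφ : Integrable fun t => P2 t * reDigammaQuarter t := integrable_norm_sq_weilMellin_mul_reDigammaQuarter hφ
  have hIφ0 : Integrable P2 := integrable_norm_sq_weilMellin_half_line hφ
  have hW2P2 : ∀ t, W2 t ≤ 4 * P2 t := fun t => norm_sq_weilMellin_twoBump_half_le N c t
  have hW2nn : ∀ t, 0 ≤ W2 t := fun t => sq_nonneg _
  have hP2nn : ∀ t, 0 ≤ P2 t := fun t => sq_nonneg _
  -- split `ψ = (ψ - m) + m`
  have hsplit : (∫ t : ℝ, W2 t * reDigammaQuarter t) =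
      (∫ t : ℝ, W2 t * (reDigammaQuarter t - m)) + m * ∫ t : ℝ, W2 t := by
    rw [← integral_const_mul, ← integral_add (hIw.sub (hIw0.const_mul m) |>.congr ?_) (hIw0.const_mul m)]
    · congr 1 with t; ring
    · exact Eventually.of_forall fun t => by simp only [Pi.sub_apply]; ring
  have h1 : (∫ t : ℝ, W2 t * (reDigammaQuarter t - m)) ≤ 4 * ∫ t : ℝ, P2 t * (reDigammaQuarter t - m) := by
    rw [← integral_const_mul]
    refine integral_mono ?_ ?_ fun t => ?_
    · exact (hIw.sub (hIw0.const_mul m)).congr (Eventually.of_forall fun t => by simp only [Pi.sub_apply]; ring)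
    · exact ((hIφ.sub (hIφ0.const_mul m)).const_mul 4).congr
        (Eventually.of_forall fun t => by simp only [Pi.sub_apply]; ring)
    · have hψ : 0 ≤ reDigammaQuarter t - m := by rw [hm]; linarith [reDigammaQuarter_zero_le t]
      calc W2 t * (reDigammaQuarter t - m) ≤ (4 * P2 t) * (reDigammaQuarter t - m) :=
            mul_le_mul_of_nonneg_right (hW2P2 t) hψ
        _ = 4 * (P2 t * (reDigammaQuarter t - m)) := by ring
  have h2 : m * (∫ t : ℝ, W2 t) ≤ 4 * |m| * ∫ t : ℝ, P2 t := by
    have hi0 : 0 ≤ ∫ t : ℝ, W2 t := integral_nonneg hW2nn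
    have hi1 : (∫ t : ℝ, W2 t) ≤ 4 * ∫ t : ℝ, P2 t := by
      rw [← integral_const_mul]
      exact integral_mono hIw0 (hIφ0.const_mul 4) hW2P2
    calc m * (∫ t : ℝ, W2 t) ≤ |m| * ∫ t : ℝ, W2 t := mul_le_mul_of_nonneg_right (le_abs_self m) hi0
      _ ≤ |m| * (4 * ∫ t : ℝ, P2 t) := mul_le_mul_of_nonneg_left hi1 (abs_nonneg m)
      _ = 4 * |m| * ∫ t : ℝ, P2 t := by ring
  rw [hsplit]
  linarith

/-! ## `1 ≤ log π` -/

/-- `1 ≤ log π` (`e < 2.72 < 3 < π`). [folklore] -/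
theorem one_le_log_pi : (1 : ℝ) ≤ Real.log Real.pi := by
  rw [Real.le_log_iff_exp_le Real.pi_pos]
  linarith [Real.exp_one_lt_d9, Real.pi_gt_three]

/-! ## The main theorem -/

/-- **Node non-negativity is load-bearing for `SignConeOscillatory`.** The crux with its node hypothesis
`∀ n ≥ 2, 0 ≤ Re F(log n)` deleted (everything else verbatim) is false: witness `k = 1`, the two-bump test
`w_c = φ(· + c/2) - φ(· - c/2)` (`φ = WeilContinuous.moll 0`) at cutoff `a = c/2 + 1` with `c = 4(1 + K)`,
`K = max 0 (D/(2π P))`, `P = 8 φ̂(0) φ̂(1) > 0`, `D` the `c`-free bound of `weilArchIntegral_twoBump_le`: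
the polar term `-P sinh²(c/4)` beats the bounded archimedean term and `Re G(0)(1 - log π) ≤ 0`. [folklore] -/
theorem signConeOscillatory_false_without_nodeNonneg :
    ¬ (∀ a : ℝ, 0 < a → ∀ (k : ℕ) (g : Fin k → ℝ → ℂ), (∀ i, (ContDiff ℝ ((⊤ : ℕ∞) : WithTop ℕ∞) (g i) ∧ HasCompactSupport (g i)) ∧ tsupport (g i) ⊆ Set.Icc (-a) a) → let F : ℝ → ℂ := fun t => ∑ i, MeasureTheory.convolution (g i) (fun u => (starRingEnd ℂ) ((g i) (-u))) (ContinuousLinearMap.mul ℂ ℂ) MeasureTheory.MeasureSpace.volume t; (∃ t : ℝ, Real.log 2 ≤ |t| ∧ (F t).re < 0) → let M : ℂ → ℂ := fun s => ∫ u : ℝ, F u * Complex.exp ((s - 1 / 2) * u); -(F 0).re ≤ (M 0 + M 1 + ((1 / (2 * Real.pi) : ℂ) * (∫ t : ℝ, M (1 / 2 + t * Complex.I) * ((Complex.digamma (1 / 4 + t / 2 * Complex.I)).re : ℂ)) - F 0 * (Real.log Real.pi : ℂ))).re) := by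
  intro h
  -- the `c`-free constants
  set I0 : ℝ := ∫ t : ℝ, (WeilContinuous.bump 0).normed volume t * Real.exp (-(t / 2)) with hI0
  set I1 : ℝ := ∫ t : ℝ, (WeilContinuous.bump 0).normed volume t * Real.exp (t / 2) with hI1
  have hI0pos : 0 < I0 := by
    have := integral_bump_normed_mul_exp_pos 0 (-(1 / 2))
    rw [hI0]; convert this using 3; ring_nf
  have hI1pos : 0 < I1 := by
    have := integral_bump_normed_mul_exp_pos 0 (1 / 2)
    rw [hI1]; convert this using 3; ring_nf
  set P : ℝ := 8 * I0 * I1 with hP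
  have hPpos : 0 < P := by positivity
  set D : ℝ := 4 * (∫ t : ℝ, ‖weilMellin (WeilContinuous.moll 0) (1 / 2 + t * I)‖ ^ 2 *
      (reDigammaQuarter t - reDigammaQuarter 0)) +
    4 * |reDigammaQuarter 0| * ∫ t : ℝ, ‖weilMellin (WeilContinuous.moll 0) (1 / 2 + t * I)‖ ^ 2 with hD
  set K : ℝ := max 0 (D / (2 * Real.pi * P)) with hK
  have hK0 : 0 ≤ K := le_max_left _ _
  have hKD : D / (2 * Real.pi) ≤ P * K := by
    have h1 : D / (2 * Real.pi * P) ≤ K := le_max_right _ _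
    have h2 : P * (D / (2 * Real.pi * P)) = D / (2 * Real.pi) := by
      field_simp
    calc D / (2 * Real.pi) = P * (D / (2 * Real.pi * P)) := h2.symm
      _ ≤ P * K := mul_le_mul_of_nonneg_left h1 hPpos.le
  set c : ℝ := 4 * (1 + K) with hc
  have hc4 : 4 ≤ c := by rw [hc]; linarith
  have hsinh : 1 + K ≤ Real.sinh (c / 4) := by
    rw [show c / 4 = 1 + K by rw [hc]; ring]
    exact Real.self_le_sinh_iff.2 (by linarith)
  have hkey_ineq : D / (2 * Real.pi) < P * Real.sinh (c / 4) ^ 2 := by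
    have h1 : (1 + K) ^ 2 ≤ Real.sinh (c / 4) ^ 2 := pow_le_pow_left₀ (by linarith) hsinh 2
    have h2 : K < (1 + K) ^ 2 := by nlinarith
    nlinarith
  -- the witness
  have hρ : (WeilContinuous.bump 0).rOut = 1 := by rw [WeilContinuous.bump_rOut]; norm_num
  set w : ℝ → ℂ := fun u => WeilContinuous.moll 0 (u + c / 2) - WeilContinuous.moll 0 (u - c / 2) with hw_def
  have hw : IsWeilTest w := isWeilTest_twoBump 0 c
  set G : ℝ → ℂ := weilConv w (weilReflect w) with hG_def
  set g : Fin 1 → ℝ → ℂ := fun _ => w with hg_def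
  set F : ℝ → ℂ := fun t => ∑ i, weilConv (g i) (weilReflect (g i)) t with hF_def
  have hFG : F = G := by
    funext t
    simp [hF_def, hg_def, hG_def]
  have ha : 0 < c / 2 + 1 := by linarith
  have hg : ∀ i, (ContDiff ℝ ((⊤ : ℕ∞) : WithTop ℕ∞) (g i) ∧ HasCompactSupport (g i)) ∧
      tsupport (g i) ⊆ Set.Icc (-(c / 2 + 1)) (c / 2 + 1) := by
    intro i
    refine ⟨hw, ?_⟩
    have := tsupport_twoBump_subset 0 (c := c) (by linarith)
    rwa [hρ] at this
  have hosc : ∃ t : ℝ, Real.log 2 ≤ |t| ∧ (F t).re < 0 := by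
    refine ⟨c, ?_, ?_⟩
    · rw [abs_of_pos (by linarith)]
      linarith [Real.log_two_lt_d9]
    · rw [hFG]
      exact re_weilConv_twoBump_neg 0 (by rw [hρ]; linarith)
  -- the mutated statement at the witness, in the Literature vocabulary (definitional unfolding)
  have key : -(F 0).re ≤ (weilPolarTerm F + weilArchTerm F).re := h (c / 2 + 1) ha 1 g hg hosc
  rw [hFG] at key
  -- the three terms
  have hG0 : G 0 = ((∫ t : ℝ, ‖w t‖ ^ 2 : ℝ) : ℂ) := weilConv_weilReflect_apply_zero w
  have hG0nn : 0 ≤ (G 0).re := by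
    rw [hG0, Complex.ofReal_re]
    exact integral_nonneg fun t => sq_nonneg _
  have hpol : (weilPolarTerm G).re = -8 * Real.sinh (c / 4) ^ 2 * I0 * I1 := re_weilPolarTerm_twoBump 0 c
  have hAI : weilArchIntegral G = ((∫ t : ℝ, ‖weilMellin w (1 / 2 + t * I)‖ ^ 2 * reDigammaQuarter t : ℝ) : ℂ) :=
    weilArchIntegral_weilConv_weilReflect hw
  have hAIle : (∫ t : ℝ, ‖weilMellin w (1 / 2 + t * I)‖ ^ 2 * reDigammaQuarter t) ≤ D :=
    weilArchIntegral_twoBump_le 0 c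
  have harch : (weilArchTerm G).re =
      1 / (2 * Real.pi) * (∫ t : ℝ, ‖weilMellin w (1 / 2 + t * I)‖ ^ 2 * reDigammaQuarter t) -
        (G 0).re * Real.log Real.pi := by
    unfold weilArchTerm
    rw [hAI, hG0]
    have e : (1 / (2 * Real.pi) : ℂ) = ((1 / (2 * Real.pi) : ℝ) : ℂ) := by push_cast; ring
    rw [e, ← Complex.ofReal_mul, ← Complex.ofReal_mul, ← Complex.ofReal_sub, Complex.ofReal_re,
      Complex.ofReal_re]
  -- assemble
  have hlogpi := one_le_log_pi
  have hpi : 0 < 2 * Real.pi := by positivity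
  rw [Complex.add_re, hpol, harch] at key
  have h3 : 1 / (2 * Real.pi) * (∫ t : ℝ, ‖weilMellin w (1 / 2 + t * I)‖ ^ 2 * reDigammaQuarter t) ≤
      D / (2 * Real.pi) := by
    rw [div_eq_mul_one_div D, mul_comm D]
    exact mul_le_mul_of_nonneg_left hAIle (by positivity)
  have h4 : (G 0).re * 1 ≤ (G 0).re * Real.log Real.pi := mul_le_mul_of_nonneg_left hlogpi hG0nn
  nlinarith [hkey_ineq, h3, h4, hG0nn, sq_nonneg (Real.sinh (c / 4)), hI0pos, hI1pos]

end Summit.RiemannHypothesis.RiemannHypothesis.Theorems.SignConeOscillatory.Negative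

end
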